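import Mathlib
import Summits.CriticalPhenomena.Ising3DConformalLimit.Theorems.PrecisionLaplacianTwoPointSpineGlueHeavyBoxes
import Summits.CriticalPhenomena.Ising3DConformalLimit.Theorems.PrecisionLaplacianEtaBoundsTransferIntegral
import Literature.Probability.LatticeModels.DiscreteParseval
import HarnessLib

/-!
# TwoPointSpineGlue (route PrecisionLaplacian, item stmt-CriticalPhenomena-4805) — lattice sums as integrals
# of step functions

Helper file 12.  Infrastructure for the scaling limit of the symbol (`…TwoPointSpineGlueSymbolLimit`):

* `mem_cell_iff`, `volume_cell`, `integral_comp_floor` — the cells `{⌊Nz⌋ = y}` of the `N`-grid have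
  volume `N^{-3}` and `∫_{ℝ³} g(⌊N z⌋) dz = N^{-3} ∑_y g(y)` for summable `g`;
* `measurable_comp_floor` — functions of `⌊N z⌋` are measurable;
* `norm_floor_le`, `norm_le_norm_floor` — `N‖z‖_∞ − 1 ≤ ‖⌊Nz⌋‖_∞ ≤ N‖z‖_∞ + 1`;
* `integrable_symbolMajorant` — the dominating function
  `A 𝟙_{[-π,π]³} ∏ᵢ |zᵢ|^{-(1+α)/3} + B (1 + ‖z‖)^{-3-α}` is integrable on `ℝ³` (`0 < α < 2`);
* `norm_siteVec_le_two_of_mem_box` — `Λ₁ ⊂ B(0,2)`.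

No definitions are introduced.
-/

noncomputable section

namespace Summit.CriticalPhenomena.Ising3DConformalLimit.Theorems.SpineGlue

open Finset Real Filter Topology MeasureTheory Literature.Probability.LatticeModels
open Summit.CriticalPhenomena.Ising3DConformalLimit.Theorems.EtaBoundsTransfer
open scoped BigOperators

/-! ### Lattice sums as integrals of step functions -/

/-- The cell of the `N`-grid with corner `y/N` is the set where `⌊N z⌋ = y`. -/
theorem mem_cell_iff {N : ℕ} (hN : 0 < N) (z : Fin 3 → ℝ) (y : Site 3) :
    z ∈ Set.pi Set.univ (fun i => Set.Ico ((y i : ℝ) / N) (((y i : ℝ) + 1) / N)) ↔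
      ∀ i, ⌊(N : ℝ) * z i⌋ = y i := by
  have hNr : (0 : ℝ) < N := by exact_mod_cast hN
  simp only [Set.mem_pi, Set.mem_univ, true_implies, Set.mem_Ico, Int.floor_eq_iff]
  refine forall_congr' fun i => ?_
  rw [div_le_iff₀ hNr, lt_div_iff₀ hNr]
  have hc : z i * N = (N : ℝ) * z i := mul_comm _ _
  rw [hc]

/-- The cells of the `N`-grid have volume `N^{-3}`. -/
theorem volume_cell {N : ℕ} (hN : 0 < N) (y : Site 3) :
    volume (Set.pi Set.univ (fun i => Set.Ico ((y i : ℝ) / N) (((y i : ℝ) + 1) / N)))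
      = ENNReal.ofReal (((N : ℝ) ^ 3)⁻¹) := by
  have hNr : (0 : ℝ) < N := by exact_mod_cast hN
  rw [volume_pi_pi]
  simp only [Real.volume_Ico]
  have : ∀ i : Fin 3, ((y i : ℝ) + 1) / N - (y i : ℝ) / N = (N : ℝ)⁻¹ := fun i => by
    field_simp; ring
  simp_rw [this]
  rw [Finset.prod_const, Finset.card_univ, Fintype.card_fin, ← ENNReal.ofReal_pow (by positivity),
    inv_pow]

/-- **Lattice sums as integrals of step functions**: for a summable `g : ℤ³ → ℝ` and `N ≥ 1`,
`∫_{ℝ³} g(⌊N z⌋) dz = N^{-3} ∑_y g(y)`. -/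
theorem integral_comp_floor {g : Site 3 → ℝ} (hg : Summable g) {N : ℕ} (hN : 0 < N) :
    ∫ z : Fin 3 → ℝ, g (fun i => ⌊(N : ℝ) * z i⌋) = ((N : ℝ) ^ 3)⁻¹ * ∑' y, g y := by
  have hNr : (0 : ℝ) < N := by exact_mod_cast hN
  set cell : Site 3 → Set (Fin 3 → ℝ) := fun y =>
    Set.pi Set.univ (fun i => Set.Ico ((y i : ℝ) / N) (((y i : ℝ) + 1) / N)) with hcell
  have hmeas : ∀ y, MeasurableSet (cell y) := fun y => MeasurableSet.univ_pi fun _ => measurableSet_Ico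
  have hvol : ∀ y, volume (cell y) = ENNReal.ofReal (((N : ℝ) ^ 3)⁻¹) := fun y => volume_cell hN y
  set F : Site 3 → (Fin 3 → ℝ) → ℝ := fun y => (cell y).indicator (fun _ => g y) with hF
  -- pointwise: only the cell of `⌊N z⌋` contributes
  have hptw : ∀ z : Fin 3 → ℝ, g (fun i => ⌊(N : ℝ) * z i⌋) = ∑' y, F y z := by
    intro z
    rw [tsum_eq_single (fun i => ⌊(N : ℝ) * z i⌋)]
    · have hz : z ∈ cell (fun i => ⌊(N : ℝ) * z i⌋) := (mem_cell_iff hN z _).2 fun i => rfl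
      simp only [hF, Set.indicator_of_mem hz]
    · intro y hy
      have hz : z ∉ cell y := fun h => hy (funext fun i => ((mem_cell_iff hN z y).1 h i)).symm
      simp only [hF, Set.indicator_of_notMem hz]
  -- each cell function is integrable with integral `N^{-3} g y`
  have hint : ∀ y, Integrable (F y) := fun y => by
    simp only [hF]
    refine IntegrableOn.integrable_indicator ?_ (hmeas y)
    refine integrableOn_const ?_
    rw [hvol]; exact ENNReal.ofReal_ne_top
  have hval : ∀ y, ∫ z, F y z = ((N : ℝ) ^ 3)⁻¹ * g y := fun y => by
    simp only [hF]
    rw [integral_indicator_const _ (hmeas y), measureReal_def, hvol, ENNReal.toReal_ofReal (by positivity),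
      smul_eq_mul]
  have hnorm : ∀ y, ∫ z, ‖F y z‖ = ((N : ℝ) ^ 3)⁻¹ * |g y| := fun y => by
    simp only [hF]
    rw [show (fun z => ‖(cell y).indicator (fun _ => g y) z‖) = (cell y).indicator (fun _ => |g y|) by
      funext z; rw [norm_indicator_eq_indicator_norm]; rfl]
    rw [integral_indicator_const _ (hmeas y), measureReal_def, hvol, ENNReal.toReal_ofReal (by positivity),
      smul_eq_mul]
  have hsum : Summable fun y => ∫ z, ‖F y z‖ := by
    simp_rw [hnorm]; exact hg.abs.mul_left _
  have h1 := hasSum_integral_of_summable_integral_norm hint hsum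
  simp_rw [hval] at h1
  have h2 : HasSum (fun y => ((N : ℝ) ^ 3)⁻¹ * g y) (((N : ℝ) ^ 3)⁻¹ * ∑' y, g y) := hg.hasSum.mul_left _
  rw [integral_congr_ae (Filter.Eventually.of_forall hptw)]
  exact (h1.unique h2)

/-- `z ↦ ⌊N z⌋` is measurable, hence so is every function of it. -/
theorem measurable_comp_floor (G : Site 3 → ℝ) (N : ℕ) :
    Measurable fun z : Fin 3 → ℝ => G (fun i => ⌊(N : ℝ) * z i⌋) := by
  have hfl : Measurable fun z : Fin 3 → ℝ => (fun i => ⌊(N : ℝ) * z i⌋ : Site 3) :=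
    measurable_pi_lambda _ fun i => Int.measurable_floor.comp ((measurable_pi_apply i).const_mul _)
  exact (measurable_of_countable G).comp hfl

/-! ### Comparison of `⌊N z⌋` with `N z` -/

/-- `‖⌊N z⌋‖_∞ ≤ N ‖z‖_∞ + 1`. -/
theorem norm_floor_le {N : ℕ} (z : Fin 3 → ℝ) :
    ‖((fun i => ⌊(N : ℝ) * z i⌋ : Site 3))‖ ≤ N * ‖z‖ + 1 := by
  refine (pi_norm_le_iff_of_nonneg (by positivity)).2 fun i => ?_
  rw [Int.norm_eq_abs]
  have h1 := Int.floor_le ((N : ℝ) * z i)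
  have h2 := Int.lt_floor_add_one ((N : ℝ) * z i)
  have hzi : |z i| ≤ ‖z‖ := by have := norm_le_pi_norm z i; rwa [Real.norm_eq_abs] at this
  have hN : (0 : ℝ) ≤ N := Nat.cast_nonneg N
  rw [abs_le]
  constructor <;> nlinarith [abs_le.1 hzi, abs_nonneg (z i)]

/-- `N ‖z‖_∞ ≤ ‖⌊N z⌋‖_∞ + 1`. -/
theorem norm_le_norm_floor {N : ℕ} (z : Fin 3 → ℝ) :
    N * ‖z‖ ≤ ‖((fun i => ⌊(N : ℝ) * z i⌋ : Site 3))‖ + 1 := by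
  rcases Nat.eq_zero_or_pos N with rfl | hN
  · simp only [Nat.cast_zero, zero_mul]; positivity
  have hNr : (0 : ℝ) < N := by exact_mod_cast hN
  have h : ‖z‖ ≤ (‖((fun i => ⌊(N : ℝ) * z i⌋ : Site 3))‖ + 1) / N := by
    refine (pi_norm_le_iff_of_nonneg (by positivity)).2 fun i => ?_
    rw [Real.norm_eq_abs, le_div_iff₀ hNr]
    have hyi : |((⌊(N : ℝ) * z i⌋ : ℤ) : ℝ)| ≤ ‖((fun i => ⌊(N : ℝ) * z i⌋ : Site 3))‖ := by
      have := norm_le_pi_norm ((fun i => ⌊(N : ℝ) * z i⌋ : Site 3)) i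
      rwa [Int.norm_eq_abs] at this
    have h1 := Int.floor_le ((N : ℝ) * z i)
    have h2 := Int.lt_floor_add_one ((N : ℝ) * z i)
    have h3 : |(N : ℝ) * z i| ≤ |((⌊(N : ℝ) * z i⌋ : ℤ) : ℝ)| + 1 := by
      have := abs_sub_abs_le_abs_sub ((N : ℝ) * z i) (((⌊(N : ℝ) * z i⌋ : ℤ) : ℝ))
      have h4 : |(N : ℝ) * z i - ((⌊(N : ℝ) * z i⌋ : ℤ) : ℝ)| ≤ 1 := by
        rw [abs_le]; constructor <;> linarith
      linarith
    rw [abs_mul, abs_of_pos hNr] at h3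
    linarith [mul_comm (z i) (N : ℝ), mul_comm |z i| (N : ℝ)]
  rw [le_div_iff₀ hNr] at h
  linarith [mul_comm ‖z‖ (N : ℝ)]

/-! ### The dominating function -/

/-- The dominating function: the product majorant on the Brillouin cube plus the Japanese bracket is
integrable on `ℝ³` (`(1+α)/3 < 1`, `3 + α > 3`). -/
theorem integrable_symbolMajorant {α : ℝ} (hα0 : 0 < α) (hα2 : α < 2) (A B : ℝ) :
    Integrable (fun z : Fin 3 → ℝ =>
      A * (Set.pi Set.univ (fun _ : Fin 3 => Set.Icc (-π) π)).indicator
            (fun z => ∏ i, |z i| ^ (-((1 + α) / 3))) z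
        + B * (1 + ‖z‖) ^ (-(3 + α))) := by
  have hπ := Real.pi_pos
  have _h := hα0
  refine (Integrable.const_mul ?_ A).add (Integrable.const_mul ?_ B)
  · set K := Set.pi Set.univ (fun _ : Fin 3 => Set.Icc (-π) π) with hK
    have hKm : MeasurableSet K := MeasurableSet.univ_pi fun _ => measurableSet_Icc
    refine IntegrableOn.integrable_indicator ?_ hKm
    have hμ : (volume : Measure (Fin 3 → ℝ)).restrict K
        = Measure.pi (fun _ : Fin 3 => (volume : Measure ℝ).restrict (Set.Icc (-π) π)) := by
      rw [MeasureTheory.volume_pi, hK, Measure.restrict_pi_pi]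
    have hs1 : (1 + α) / 3 < 1 := by rw [div_lt_one (by norm_num)]; linarith
    have hg_int : Integrable (fun t : ℝ => |t| ^ (-((1 + α) / 3)))
        ((volume : Measure ℝ).restrict (Set.Icc (-π) π)) := by
      have h := intervalIntegrable_abs_rpow_neg hs1 (-π) π
      rw [intervalIntegrable_iff_integrableOn_Icc_of_le (by linarith)] at h
      exact h
    show Integrable _ ((volume : Measure (Fin 3 → ℝ)).restrict K)
    rw [hμ]
    exact Integrable.fintype_prod (f := fun _ : Fin 3 => fun t : ℝ => |t| ^ (-((1 + α) / 3))) (fun _ => hg_int)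
  · have h3 : (Module.finrank ℝ (Fin 3 → ℝ) : ℝ) < 3 + α := by
      rw [Module.finrank_fin_fun]; push_cast; linarith
    exact integrable_one_add_norm h3

/-- Sites of the unit box `Λ₁` embed into the Euclidean ball of radius `2`. -/
theorem norm_siteVec_le_two_of_mem_box {y : Site 3} (hy : y ∈ box 3 1) : ‖siteVec y‖ ≤ 2 := by
  rw [EuclideanSpace.norm_eq]
  have hcoord : ∀ i, ‖(siteVec y) i‖ ^ 2 ≤ 1 := fun i => by
    rw [siteVec_apply, Real.norm_eq_abs, sq_abs]
    have := (mem_box.1 hy) i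
    have h1 : |((y i : ℤ) : ℝ)| ≤ 1 := by
      rw [abs_le]; exact ⟨by exact_mod_cast this.1, by exact_mod_cast this.2⟩
    nlinarith [abs_nonneg ((y i : ℤ) : ℝ), sq_abs ((y i : ℤ) : ℝ)]
  calc Real.sqrt (∑ i, ‖(siteVec y) i‖ ^ 2) ≤ Real.sqrt 3 := by
        apply Real.sqrt_le_sqrt
        calc ∑ i, ‖(siteVec y) i‖ ^ 2 ≤ ∑ _i : Fin 3, (1 : ℝ) := Finset.sum_le_sum fun i _ => hcoord i
          _ = 3 := by simp
    _ ≤ 2 := by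
        rw [Real.sqrt_le_left (by norm_num)]; norm_num

end Summit.CriticalPhenomena.Ising3DConformalLimit.Theorems.SpineGlue

end
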